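import Summits.NavierStokesRegularity.NavierStokesRegularity.Theorems.AdaptedFrequencyFrequencyRigidityViscosityNormalisation
import Summits.NavierStokesRegularity.NavierStokesRegularity.Theorems.AdaptedFrequencyFrequencyRigidityClassicalSuitableSlab
import Summits.NavierStokesRegularity.NavierStokesRegularity.Theses.RecurrentProfiles
import HarnessLib

/-!
# Crux `FrequencyRigidity` (stmt-NavierStokesRegularity-2955), line `scaled-energy-split`:
# the finite piece from `NoTypeIRateProfile`, and its axisymmetric leaf

Helper file (`--supports stmt-NavierStokesRegularity-2955`; theorems only, sorry-free).  Two consequences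
of "every witness is backward-singular at the pole" (`isBackwardSingularPoint_of_witness`) for Stub 2
`stub_finiteScaledEnergyLiouville` (flat Liouville in the Albritton–Barker class):

* `stub_finiteOfNoTypeIRateProfile` — **Stub 2 ⇐ stmt-1588**: the target `NoTypeIRateProfile` of routes
  RecurrentProfiles / DulacContraction (no Type-I-rate profile in the local-energy class is backward-singular
  at the origin) implies the finite piece.  A finite-scaled-energy witness, viscosity-normalised
  (`classical_viscosity`, `typeIBound_viscosity_lt_top`, `hasTypeITimeDecay_viscosity`,
  `isBackwardSingularPoint_viscosity`), is a classical — hence suitable weak (`stub_classicalSuitableSlab`) —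
  solution on the slab with `𝐈 < ⊤`, the Type-I rate and a backward-singular origin: exactly what
  `NoTypeIRateProfile` forbids.  So the finite piece of the crux is ONE Liouville problem staffed under three
  names (census R2), and inherits the compactness / persistence-of-singularities phase space of that class.
* `stub_finiteAxisymmetricLeaf` — **the axisymmetric case of Stub 2 is CLOSED**: no axisymmetric witness
  has finite `𝐈` (Seregin–Šverák 2009 Thm 3.1 through `stub_axisymmetricFlatCore_unit`; in the crux's
  original class the axisymmetric case was NOT closable, the `L³(Q₁)` hypothesis failing for non-decaying
  profiles — lead c4 — whereas `C(Q) ≤ 𝐈 < ⊤` supplies it here).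

## References

* D. Albritton, T. Barker, J. Math. Fluid Mech. 21 (2019), Thm 1.1, §3. [AlbrittonBarker2019]
* G. Seregin, V. Šverák, Comm. PDE 34 (2009), Thm 3.1. [SereginSverak2009]
-/

noncomputable section

set_option linter.dupNamespace false

namespace Summit.NavierStokesRegularity.NavierStokesRegularity.Theorems.FrequencyRigidity.ScaledEnergySplit

open Literature.Analysis.FluidPDE MeasureTheory Set Filter Topology Function Metric
open Summit.NavierStokesRegularity.NavierStokesRegularity.Theorems.FrequencyRigidity.Negative (E3)

/-- **Stub 2 from `NoTypeIRateProfile`, modulo the class bookkeeping `classical ⇒ suitable`.** [cite: AlbrittonBarker2019, §3] -/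
theorem finite_of_noTypeIRateProfile_of_suitable
    (hSuit : ∀ (u : ℝ → EuclideanSpace ℝ (Fin 3) → EuclideanSpace ℝ (Fin 3)) (p : ℝ → EuclideanSpace ℝ (Fin 3) → ℝ), Literature.Analysis.FluidPDE.IsClassicalNSSolutionOn (Set.Iio 0) 1 0 u p → Literature.Analysis.FluidPDE.IsSuitableWeakSolutionOn (Literature.Analysis.FluidPDE.slab (EuclideanSpace ℝ (Fin 3)) (Set.Iio 0) isOpen_Iio) 1 0 u p ∧ Literature.Analysis.FluidPDE.HasWeakSpatialGradientOn (Literature.Analysis.FluidPDE.slab (EuclideanSpace ℝ (Fin 3)) (Set.Iio 0) isOpen_Iio) u (fun t x => fderiv ℝ (u t) x))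
    (h1588 : Summit.NavierStokesRegularity.NavierStokesRegularity.Theses.RecurrentProfiles.NoTypeIRateProfile) :
    ¬ ∃ (ν C Λ₀ : ℝ) (v : ℝ → EuclideanSpace ℝ (Fin 3) → EuclideanSpace ℝ (Fin 3)) (q : ℝ → EuclideanSpace ℝ (Fin 3) → ℝ) (K : ℝ → EuclideanSpace ℝ (Fin 3) → ℝ), (0 < ν ∧ Literature.Analysis.FluidPDE.IsClassicalNSSolutionOn (Set.Iio 0) ν 0 v q ∧ (∀ t ∈ Set.Iio (0:ℝ), ∀ x, ‖v t x‖ ≤ C / Real.sqrt (-t)) ∧ ContDiffOn ℝ 2 (Function.uncurry K) (Set.Iio (0:ℝ) ×ˢ Set.univ) ∧ (∀ t ∈ Set.Iio (0:ℝ), ∀ x, 0 < K t x) ∧ (∀ t ∈ Set.Iio (0:ℝ), ∀ x, Literature.Analysis.FluidPDE.timeDerivWithin (Set.Iio (0:ℝ)) K t x + fderiv ℝ (K t) x (v t x) + ν * Laplacian.laplacian (K t) x = 0) ∧ (∀ t ∈ Set.Iio (0:ℝ), ∫ x, K t x = 1) ∧ (∀ φ : EuclideanSpace ℝ (Fin 3)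 → ℝ, Continuous φ → (∃ M : ℝ, ∀ x, |φ x| ≤ M) → Filter.Tendsto (fun t => ∫ x, φ x * K t x) (nhdsWithin (0:ℝ) (Set.Iio (0:ℝ))) (nhds (φ (0 : EuclideanSpace ℝ (Fin 3))))) ∧ (∃ c₁ c₂ C₁ C₂ : ℝ, 0 < c₁ ∧ 0 < c₂ ∧ 0 < C₁ ∧ 0 < C₂ ∧ ∀ t ∈ Set.Iio (0:ℝ), ∀ x, c₁ * ((0:ℝ) - t) ^ (-(3:ℝ) / 2) * Real.exp (-(‖x - (0 : EuclideanSpace ℝ (Fin 3))‖ ^ 2) / (c₂ * ((0:ℝ) - t))) ≤ K t x ∧ K t x ≤ C₁ * ((0:ℝ) - t) ^ (-(3:ℝ) / 2) * Real.exp (-(‖x - (0 : EuclideanSpace ℝ (Fin 3))‖ ^ 2) / (C₂ * ((0:ℝ) - t)))) ∧ (∀ H Λ : ℝ → ℝ, H = (fun t => ∫ x, ‖Literature.Analysis.FluidPDE.curl (v t) x‖ ^ 2 * K t x) → Λ = (fun t => (0 - t) * deriv H t / H t) → (∀ t ∈ Set.Iio (0:ℝ), 0 < H t) ∧ (∀ t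 ∈ Set.Iio (0:ℝ), Λ t = Λ₀))) ∧ Literature.Analysis.FluidPDE.typeIBound (Set.Iio (0:ℝ) ×ˢ Set.univ) v q (fun t x => fderiv ℝ (v t) x) < ⊤ := by
  rintro ⟨ν, C, Λ₀, v, q, K, hbody, hI⟩
  obtain ⟨hν, hNS, hTI, hKc, hCmp, hF⟩ := (body_iff_bundles ν C Λ₀ v q K).1 hbody
  have hsing := isBackwardSingularPoint_of_witness hν hNS hTI hKc hCmp hF
  have h1 := classical_viscosity hν hNS
  have h2 := hasTypeITimeDecay_viscosity (C := C) hν hTI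
  have h3 := typeIBound_viscosity_lt_top (q := q) hν hI
  have h4 := isBackwardSingularPoint_viscosity hν hsing
  obtain ⟨hsw, hG⟩ := hSuit _ _ h1
  exact h1588 _ _ _ (C / Real.sqrt ν) hsw hG h3 h2 h4

/-- **The axisymmetric leaf of Stub 2, modulo its unit-viscosity core.** [cite: SereginSverak2009, Thm 3.1] -/
theorem finite_axisymmetric_of_core
    (hCore : ∀ (C : ℝ) (u : ℝ → EuclideanSpace ℝ (Fin 3) → EuclideanSpace ℝ (Fin 3)) (p : ℝ → EuclideanSpace ℝ (Fin 3) → ℝ), Literature.Analysis.FluidPDE.IsClassicalNSSolutionOn (Set.Iio 0) 1 0 u p → Literature.Analysis.FluidPDE.HasTypeITimeDecay C u → (∀ t ∈ Set.Iio (0:ℝ), Literature.Analysis.FluidPDE.IsAxisymmetric (u t)) → Literature.Analysis.FluidPDE.typeIBound (Set.Iio (0:ℝ) ×ˢ Set.univ) u p (fun t x => fderiv ℝ (u t) x) < ⊤ → ¬ Literature.Analysis.FluidPDE.IsBackwardSingularPoint u 0) :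
    ∀ (ν C Λ₀ : ℝ) (v : ℝ → EuclideanSpace ℝ (Fin 3) → EuclideanSpace ℝ (Fin 3)) (q : ℝ → EuclideanSpace ℝ (Fin 3) → ℝ) (K : ℝ → EuclideanSpace ℝ (Fin 3) → ℝ), (0 < ν ∧ Literature.Analysis.FluidPDE.IsClassicalNSSolutionOn (Set.Iio 0) ν 0 v q ∧ (∀ t ∈ Set.Iio (0:ℝ), ∀ x, ‖v t x‖ ≤ C / Real.sqrt (-t)) ∧ ContDiffOn ℝ 2 (Function.uncurry K) (Set.Iio (0:ℝ) ×ˢ Set.univ) ∧ (∀ t ∈ Set.Iio (0:ℝ), ∀ x, 0 < K t x) ∧ (∀ t ∈ Set.Iio (0:ℝ), ∀ x, Literature.Analysis.FluidPDE.timeDerivWithin (Set.Iio (0:ℝ)) K t x + fderiv ℝ (K t) x (v t x) + ν * Laplacian.laplacian (K t) x = 0) ∧ (∀ t ∈ Set.Iio (0:ℝ), ∫ x, K t x = 1) ∧ (∀ φ : EuclideanSpace ℝ (Fin 3) → ℝ, Continuous φ → (∃ M : ℝ, ∀ x, |φ x| ≤ M) → Filter.Tendsto (fun t => ∫ x, φ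 x * K t x) (nhdsWithin (0:ℝ) (Set.Iio (0:ℝ))) (nhds (φ (0 : EuclideanSpace ℝ (Fin 3))))) ∧ (∃ c₁ c₂ C₁ C₂ : ℝ, 0 < c₁ ∧ 0 < c₂ ∧ 0 < C₁ ∧ 0 < C₂ ∧ ∀ t ∈ Set.Iio (0:ℝ), ∀ x, c₁ * ((0:ℝ) - t) ^ (-(3:ℝ) / 2) * Real.exp (-(‖x - (0 : EuclideanSpace ℝ (Fin 3))‖ ^ 2) / (c₂ * ((0:ℝ) - t))) ≤ K t x ∧ K t x ≤ C₁ * ((0:ℝ) - t) ^ (-(3:ℝ) / 2) * Real.exp (-(‖x - (0 : EuclideanSpace ℝ (Fin 3))‖ ^ 2) / (C₂ * ((0:ℝ) - t)))) ∧ (∀ H Λ : ℝ → ℝ, H = (fun t => ∫ x, ‖Literature.Analysis.FluidPDE.curl (v t) x‖ ^ 2 * K t x) → Λ = (fun t => (0 - t) * deriv H t / H t) → (∀ t ∈ Set.Iio (0:ℝ), 0 < H t) ∧ (∀ t ∈ Set.Iio (0:ℝ), Λ t = Λ₀))) → Literature.Analysis.FluidPDE.typeIBound (Set.Iio (0:ℝ)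 ×ˢ Set.univ) v q (fun t x => fderiv ℝ (v t) x) < ⊤ → (∀ t ∈ Set.Iio (0:ℝ), Literature.Analysis.FluidPDE.IsAxisymmetric (v t)) → False := by
  rintro ν C Λ₀ v q K hbody hI hax
  obtain ⟨hν, hNS, hTI, hKc, hCmp, hF⟩ := (body_iff_bundles ν C Λ₀ v q K).1 hbody
  have hsing := isBackwardSingularPoint_of_witness hν hNS hTI hKc hCmp hF
  have h1 := classical_viscosity hν hNS
  have h2 := hasTypeITimeDecay_viscosity (C := C) hν hTI
  have h3 := typeIBound_viscosity_lt_top (q := q) hν hI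
  have h4 := isBackwardSingularPoint_viscosity hν hsing
  exact hCore (C / Real.sqrt ν) _ _ h1 h2 (isAxisymmetric_viscosity hax hν) h3 h4

/-! ## Registered sub-goal: Stub 2 ⇐ stmt-1588 -/

/-- **Registered sub-goal `stub_finiteOfNoTypeIRateProfile` (line `scaled-energy-split`): Stub 2
`stub_finiteScaledEnergyLiouville` — the finite-scaled-energy flat Liouville theorem — FOLLOWS FROM the
target `NoTypeIRateProfile` (stmt-NavierStokesRegularity-1588) of routes RecurrentProfiles /
DulacContraction.**  Composition of `finite_of_noTypeIRateProfile_of_suitable` with the landed class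
bookkeeping `stub_classicalSuitableSlab`.  Conditional on an OPEN item (it is an implication, not a
discharge): the open core of both is Pineau–Vicol 2026 Conj. 1.1 on its window. [cite: AlbrittonBarker2019, Thm 1.1] -/
theorem stub_finiteOfNoTypeIRateProfile : Summit.NavierStokesRegularity.NavierStokesRegularity.Theses.RecurrentProfiles.NoTypeIRateProfile → ¬ ∃ (ν C Λ₀ : ℝ) (v : ℝ → EuclideanSpace ℝ (Fin 3) → EuclideanSpace ℝ (Fin 3)) (q : ℝ → EuclideanSpace ℝ (Fin 3) → ℝ) (K : ℝ → EuclideanSpace ℝ (Fin 3) → ℝ), (0 < ν ∧ Literature.Analysis.FluidPDE.IsClassicalNSSolutionOn (Set.Iio 0) ν 0 v q ∧ (∀ t ∈ Set.Iio (0:ℝ), ∀ x, ‖v t x‖ ≤ C / Real.sqrt (-t)) ∧ ContDiffOn ℝ 2 (Function.uncurry K) (Set.Iio (0:ℝ) ×ˢ Set.univ) ∧ (∀ t ∈ Set.Iio (0:ℝ), ∀ x, 0 < K t x) ∧ (∀ t ∈ Set.Iio (0:ℝ), ∀ x, Literature.Analysis.FluidPDE.timeDerivWithin (Set.Iio (0:ℝ))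 K t x + fderiv ℝ (K t) x (v t x) + ν * Laplacian.laplacian (K t) x = 0) ∧ (∀ t ∈ Set.Iio (0:ℝ), ∫ x, K t x = 1) ∧ (∀ φ : EuclideanSpace ℝ (Fin 3) → ℝ, Continuous φ → (∃ M : ℝ, ∀ x, |φ x| ≤ M) → Filter.Tendsto (fun t => ∫ x, φ x * K t x) (nhdsWithin (0:ℝ) (Set.Iio (0:ℝ))) (nhds (φ (0 : EuclideanSpace ℝ (Fin 3))))) ∧ (∃ c₁ c₂ C₁ C₂ : ℝ, 0 < c₁ ∧ 0 < c₂ ∧ 0 < C₁ ∧ 0 < C₂ ∧ ∀ t ∈ Set.Iio (0:ℝ), ∀ x, c₁ * ((0:ℝ) - t) ^ (-(3:ℝ) / 2) * Real.exp (-(‖x - (0 : EuclideanSpace ℝ (Fin 3))‖ ^ 2) / (c₂ * ((0:ℝ) - t))) ≤ K t x ∧ K t x ≤ C₁ * ((0:ℝ) - t) ^ (-(3:ℝ) / 2) * Real.exp (-(‖x - (0 : EuclideanSpace ℝ (Fin 3))‖ ^ 2) / (C₂ * ((0:ℝ) - t)))) ∧ (∀ H Λ : ℝ → ℝ, H = (fun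 t => ∫ x, ‖Literature.Analysis.FluidPDE.curl (v t) x‖ ^ 2 * K t x) → Λ = (fun t => (0 - t) * deriv H t / H t) → (∀ t ∈ Set.Iio (0:ℝ), 0 < H t) ∧ (∀ t ∈ Set.Iio (0:ℝ), Λ t = Λ₀))) ∧ Literature.Analysis.FluidPDE.typeIBound (Set.Iio (0:ℝ) ×ˢ Set.univ) v q (fun t x => fderiv ℝ (v t) x) < ⊤ :=
  finite_of_noTypeIRateProfile_of_suitable stub_classicalSuitableSlab

end Summit.NavierStokesRegularity.NavierStokesRegularity.Theorems.FrequencyRigidity.ScaledEnergySplit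

end
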